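import Summits.HodgeConjecture.HodgeConjecture.Theorems.LinearSystemTorelliLocalTubeSpanLatticeCoordinates
import Summits.HodgeConjecture.HodgeConjecture.Theorems.LinearSystemTorelliLocalTubeSpanUnimodularTransitivityLemmas
import Summits.HodgeConjecture.HodgeConjecture.Theorems.LinearSystemTorelliLocalTubeSpanCoprimeShiftSub
import Mathlib.RingTheory.Coprime.Lemmas
import Mathlib.Tactic.Module

/-!
# Route LinearSystemTorelli — crux `LocalTubeSpan` (stmt-HodgeConjecture-2490): the asymmetric engine

Helper file (`--supports stmt-HodgeConjecture-2490`, line `Sketch` of the crux chain, cycle 10,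
continuation lead c7; the lead's stub `stub_asymEngine`, worker A) of THEOREM U⁺: "the level-2
congruence subgroup of an integral lattice containing a unimodular pair is generated by the squares of
transvections" — WITHOUT any unimodularity hypothesis on the lattice.  Its induction moves a DUAL vector
`y` (not a lattice vector) back to itself; this file is the engine of that step.

Let `Λ = ℤS` be a lattice in the `ℚ`-space `V` on which the alternating form `B` is integral, let
`G ≤ GL(V)` contain, for every `a ∈ Λ`, a unit acting as the squared transvection
`T_a² : v ↦ v - 2⟨v,a⟩a`, let `u, w ∈ Λ` be a unimodular pair (`⟨u,w⟩ = 1`), `δ ∈ Λ` orthogonal to it,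
and let `y` be ANY vector with `y ⟂ u, w`, `⟨y, δ⟩ = 1` and `⟨y, Λ⟩ ⊆ ℤ`.  MAIN THEOREM
`localTubeSpan_asymEngine`: every `t ∈ y + 2Λ` having a partner `x ∈ Λ` (`⟨t, x⟩ = 1`) is `g⁻¹ y` for
some `g ∈ G` (`g t = y`).

Proof — at most four moves `T_a^{±2}` (`a ∈ Λ`); write `t = y + 2c` (`c ∈ Λ`), `α = ⟨c, w⟩`,
`β = ⟨c, u⟩` (integers), so that `⟨t, w⟩ = 2α`, `⟨t, u⟩ = 2β`, and a move `T_a²` replaces `c` by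
`c - ⟨t, a⟩ a`:
* `localTubeSpan_asymEngine_finish` (MOVE 3) — if `⟨y, c⟩ = ±1` then `⟨t, c⟩ = ±1` and `T_c^{±2} t = y`;
* `localTubeSpan_asymEngine_bezout` (MOVE 2) — if `pα + qβ = 1` and `ν = ⟨y, c⟩` is EVEN, the lattice
  vector `a = jq u + jp w + δ` (`2j = ν - 1 - ⟨t, δ⟩`) has `⟨y, a⟩ = 1`, `⟨t, a⟩ = ν - 1`, so the new
  `c' = c - (ν - 1)a` has `⟨y, c'⟩ = 1`;
* `localTubeSpan_asymEngine_ofCoprime` — if `ν` is odd, the move along `δ` (`⟨t, δ⟩ = 1 + 2⟨c, δ⟩` odd,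
  `⟨y, δ⟩ = 1`, `δ ⟂ u, w`) first makes `ν` even without touching `(α, β)`;
* `localTubeSpan_asymEngine_moveU` / `…_moveW` (MOVE 1) — for `m ∈ Λ ∩ {u,w}^⊥` with `⟨t, m⟩ = κ` the
  move along `u + jm` (resp. `w + jm`) replaces `(α, β)` by `(α - 2β - jκ, β)` (resp.
  `(α, β + 2α + jκ)`);
* `localTubeSpan_asymEngine` — a partner `x` of `t` gives `m = x - ⟨x,w⟩u + ⟨x,u⟩w ⟂ u, w` with
  `κ = ⟨t, m⟩ = 1 - 2⟨x,w⟩β + 2⟨x,u⟩α`, so `κ, α, β` generate the unit ideal, and the COPRIME SHIFT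
  `localTubeSpan_coprimeShiftSub` of `…CoprimeShiftSub` (`∃ j, IsCoprime (α - jκ) β` whenever
  `β ≠ 0`, by prime avoidance) makes the new pair coprime — along `u + jm` if `β ≠ 0`, along `w + jm`
  if `α ≠ 0`; if `α = β = 0` then `κ = 1` and `j = -1` yields the pair `(1, 0)`.

No named facts (the squares are a hypothesis); no `sorry`.
-/

-- `Summit.HodgeConjecture.HodgeConjecture.Theorems` is the mandated namespace (single-conjunct summit:
-- Sub = Summit), which `linter.dupNamespace` flags on every declaration; the lakefile turns the
-- linter off tree-wide (weak option), restated here so stand-alone elaboration is warning-free too.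
set_option linter.dupNamespace false

noncomputable section

open Literature.AlgebraicGeometry.HodgeTheory

namespace Summit.HodgeConjecture.HodgeConjecture.Theorems

/-! ### The moves -/

section Engine

variable {V : Type} [AddCommGroup V] [Module ℚ V]

/-- Pull-back along a move: if `g ∈ G` and `g t` is moved to `y` by an element of `G`, so is `t`.
[folklore] -/
theorem localTubeSpan_asymEngine_pull (G : Subgroup (V →ₗ[ℚ] V)ˣ) {g : (V →ₗ[ℚ] V)ˣ} (hg : g ∈ G)
    {t y : V} (h : ∃ g' ∈ G, ((g' : (V →ₗ[ℚ] V)ˣ) : V →ₗ[ℚ] V) ((g : V →ₗ[ℚ] V) t) = y) :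
    ∃ g' ∈ G, ((g' : (V →ₗ[ℚ] V)ˣ) : V →ₗ[ℚ] V) t = y := by
  obtain ⟨g', hg', h'⟩ := h
  exact ⟨g' * g, G.mul_mem hg' hg, by rw [Units.val_mul, Module.End.mul_apply]; exact h'⟩

/-- MOVE 3 (the finish).  If `t = y + 2c` with `c ∈ ℤS` and `⟨y, c⟩ = ±1`, then `⟨t, c⟩ = ±1` and
`T_c^{±2} t = y`. [folklore] -/
theorem localTubeSpan_asymEngine_finish (B : LinearMap.BilinForm ℚ V) (hB : B.IsAlt) (S : Set V)
    (G : Subgroup (V →ₗ[ℚ] V)ˣ)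
    (hsq : ∀ a ∈ Submodule.span ℤ S, ∃ g ∈ G, ∀ v : V,
      ((g : (V →ₗ[ℚ] V)ˣ) : V →ₗ[ℚ] V) v = v - (2 : ℚ) • (B v a • a))
    (y : V) {t c : V} (hc : c ∈ Submodule.span ℤ S) (ht : t = y + (2 : ℚ) • c)
    (hyc : B y c = 1 ∨ B y c = -1) :
    ∃ g ∈ G, ((g : (V →ₗ[ℚ] V)ˣ) : V →ₗ[ℚ] V) t = y := by
  obtain ⟨g, hg, hgv⟩ := hsq c hc
  have htc : B t c = B y c := by
    rw [ht, map_add, map_smul, LinearMap.add_apply, LinearMap.smul_apply, hB.self_eq_zero,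
      smul_zero, add_zero]
  rcases hyc with h1 | h1
  · refine ⟨g, hg, ?_⟩
    rw [hgv, htc, h1, ht]
    module
  · refine ⟨g⁻¹, G.inv_mem hg, ?_⟩
    rw [localTubeSpan_sqMove_inv_apply B hB c g hgv, htc, h1, ht]
    module

/-- MOVE 2 (Bézout).  `t = y + 2c` (`c ∈ ℤS`) with `(⟨c,w⟩, ⟨c,u⟩) = (α, β)` coprime, `pα + qβ = 1`,
and `⟨y, c⟩ = 2ν` EVEN.  With `M = ⟨c, δ⟩` and `j = ν - 1 - M` the lattice vector
`a = jq u + jp w + δ` has `⟨y, a⟩ = 1` and `⟨t, a⟩ = 2ν - 1`, so `T_a² t = y + 2c'` with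
`c' = c - (2ν - 1)a` and `⟨y, c'⟩ = 1`, and the finish applies. [folklore] -/
theorem localTubeSpan_asymEngine_bezout (B : LinearMap.BilinForm ℚ V) (hB : B.IsAlt) (S : Set V)
    (hint : ∀ δ ∈ S, ∀ δ' ∈ S, ∃ n : ℤ, B δ δ' = n)
    (G : Subgroup (V →ₗ[ℚ] V)ˣ)
    (hsq : ∀ a ∈ Submodule.span ℤ S, ∃ g ∈ G, ∀ v : V,
      ((g : (V →ₗ[ℚ] V)ˣ) : V →ₗ[ℚ] V) v = v - (2 : ℚ) • (B v a • a))
    {u w δ : V} (hu : u ∈ Submodule.span ℤ S) (hw : w ∈ Submodule.span ℤ S)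
    (hδ : δ ∈ Submodule.span ℤ S)
    (y : V) (hyu : B y u = 0) (hyw : B y w = 0) (hyδ : B y δ = 1)
    {t c : V} (hc : c ∈ Submodule.span ℤ S) (ht : t = y + (2 : ℚ) • c)
    {α β ν : ℤ} (hα : B c w = α) (hβ : B c u = β) (hcop : IsCoprime α β) (hν : B y c = 2 * ν) :
    ∃ g ∈ G, ((g : (V →ₗ[ℚ] V)ˣ) : V →ₗ[ℚ] V) t = y := by
  obtain ⟨p, q, hpq⟩ := hcop
  have hpq' : (p : ℚ) * α + q * β = 1 := by exact_mod_cast hpq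
  obtain ⟨M, hM⟩ := localTubeSpan_integral_span B S hint hc hδ
  obtain ⟨a, ha⟩ : ∃ a : V,
      a = (((ν - 1 - M) * q : ℤ) : ℚ) • u + (((ν - 1 - M) * p : ℤ) : ℚ) • w + δ := ⟨_, rfl⟩
  have haΛ : a ∈ Submodule.span ℤ S := by
    rw [ha]
    exact Submodule.add_mem _ (Submodule.add_mem _ (localTubeSpan_intCast_smul_mem S hu _)
      (localTubeSpan_intCast_smul_mem S hw _)) hδ
  have hya : B y a = 1 := by
    rw [ha]
    simp only [map_add, map_smul, smul_eq_mul, hyu, hyw, hyδ, mul_zero, zero_add]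
  have hta : B t a = 2 * ν - 1 := by
    rw [ht, ha]
    simp only [map_add, map_smul, LinearMap.add_apply, LinearMap.smul_apply, smul_eq_mul, hyu, hyw,
      hyδ, hα, hβ, hM]
    push_cast
    linear_combination (2 * ((ν : ℚ) - 1 - M)) * hpq'
  obtain ⟨g, hg, hgv⟩ := hsq a haΛ
  refine localTubeSpan_asymEngine_pull G hg
    (localTubeSpan_asymEngine_finish B hB S G hsq y (c := c - ((2 * ν - 1 : ℤ) : ℚ) • a)
      (Submodule.sub_mem _ hc (localTubeSpan_intCast_smul_mem S haΛ _)) ?_ (Or.inl ?_))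
  · rw [hgv, hta, ht]
    push_cast
    module
  · simp only [map_sub, map_smul, smul_eq_mul, hya, hν]
    push_cast
    ring

/-- MOVES 2–3 from a COPRIME pair.  `t = y + 2c` (`c ∈ ℤS`) with `(⟨c,w⟩, ⟨c,u⟩) = (α, β)` coprime is
moved to `y`: if `ν = ⟨y, c⟩` is odd, the move along `δ` (`⟨t, δ⟩ = 1 + 2⟨c, δ⟩` odd, `⟨y, δ⟩ = 1`,
`δ ⟂ u, w`) first makes it even, keeping the pair `(α, β)`. [folklore] -/
theorem localTubeSpan_asymEngine_ofCoprime (B : LinearMap.BilinForm ℚ V) (hB : B.IsAlt) (S : Set V)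
    (hint : ∀ δ ∈ S, ∀ δ' ∈ S, ∃ n : ℤ, B δ δ' = n)
    (G : Subgroup (V →ₗ[ℚ] V)ˣ)
    (hsq : ∀ a ∈ Submodule.span ℤ S, ∃ g ∈ G, ∀ v : V,
      ((g : (V →ₗ[ℚ] V)ˣ) : V →ₗ[ℚ] V) v = v - (2 : ℚ) • (B v a • a))
    {u w δ : V} (hu : u ∈ Submodule.span ℤ S) (hw : w ∈ Submodule.span ℤ S)
    (hδ : δ ∈ Submodule.span ℤ S) (hδu : B δ u = 0) (hδw : B δ w = 0)
    (y : V) (hyu : B y u = 0) (hyw : B y w = 0) (hyδ : B y δ = 1)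
    (hyint : ∀ a ∈ Submodule.span ℤ S, ∃ z : ℤ, B y a = z)
    {t c : V} (hc : c ∈ Submodule.span ℤ S) (ht : t = y + (2 : ℚ) • c)
    {α β : ℤ} (hα : B c w = α) (hβ : B c u = β) (hcop : IsCoprime α β) :
    ∃ g ∈ G, ((g : (V →ₗ[ℚ] V)ˣ) : V →ₗ[ℚ] V) t = y := by
  obtain ⟨ν, hν⟩ := hyint c hc
  obtain ⟨k, hk | hk⟩ := Int.even_or_odd' ν
  · -- `ν = 2k`: Bézout directly
    exact localTubeSpan_asymEngine_bezout B hB S hint G hsq hu hw hδ y hyu hyw hyδ hc ht hα hβ hcop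
      (ν := k) (by rw [hν, hk]; norm_num)
  · -- `ν = 2k + 1`: first the move along `δ`
    obtain ⟨M, hM⟩ := localTubeSpan_integral_span B S hint hc hδ
    obtain ⟨g, hg, hgv⟩ := hsq δ hδ
    have htδ : B t δ = 1 + 2 * M := by
      rw [ht, map_add, map_smul, LinearMap.add_apply, LinearMap.smul_apply, hyδ, hM, smul_eq_mul]
    refine localTubeSpan_asymEngine_pull G hg
      (localTubeSpan_asymEngine_bezout B hB S hint G hsq hu hw hδ y hyu hyw hyδ
        (c := c - ((1 + 2 * M : ℤ) : ℚ) • δ)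
        (Submodule.sub_mem _ hc (localTubeSpan_intCast_smul_mem S hδ _)) ?_ (α := α) (β := β)
        (ν := k - M) ?_ ?_ hcop ?_)
    · rw [hgv, htδ, ht]
      push_cast
      module
    · rw [map_sub, map_smul, LinearMap.sub_apply, LinearMap.smul_apply, hα, hδw, smul_zero,
        sub_zero]
    · rw [map_sub, map_smul, LinearMap.sub_apply, LinearMap.smul_apply, hβ, hδu, smul_zero,
        sub_zero]
    · simp only [map_sub, map_smul, smul_eq_mul, hν, hyδ, hk]
      push_cast
      ring

/-- MOVE 1 along `u + jm`.  `t = y + 2c`, `(⟨c,w⟩, ⟨c,u⟩) = (α, β)`, `m ∈ ℤS ∩ {u, w}^⊥` with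
`⟨t, m⟩ = κ`: the move along `a = u + jm` (`⟨t, a⟩ = 2β + jκ`, `⟨a, w⟩ = 1`, `⟨a, u⟩ = 0`) replaces
`(α, β)` by `(α - 2β - jκ, β)`, which is coprime as soon as `α - jκ` is coprime to `β`. [folklore] -/
theorem localTubeSpan_asymEngine_moveU (B : LinearMap.BilinForm ℚ V) (hB : B.IsAlt) (S : Set V)
    (hint : ∀ δ ∈ S, ∀ δ' ∈ S, ∃ n : ℤ, B δ δ' = n)
    (G : Subgroup (V →ₗ[ℚ] V)ˣ)
    (hsq : ∀ a ∈ Submodule.span ℤ S, ∃ g ∈ G, ∀ v : V,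
      ((g : (V →ₗ[ℚ] V)ˣ) : V →ₗ[ℚ] V) v = v - (2 : ℚ) • (B v a • a))
    {u w δ : V} (hu : u ∈ Submodule.span ℤ S) (hw : w ∈ Submodule.span ℤ S)
    (hδ : δ ∈ Submodule.span ℤ S) (huw : B u w = 1) (hδu : B δ u = 0) (hδw : B δ w = 0)
    (y : V) (hyu : B y u = 0) (hyw : B y w = 0) (hyδ : B y δ = 1)
    (hyint : ∀ a ∈ Submodule.span ℤ S, ∃ z : ℤ, B y a = z)
    {t c : V} (hc : c ∈ Submodule.span ℤ S) (ht : t = y + (2 : ℚ) • c)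
    {α β : ℤ} (hα : B c w = α) (hβ : B c u = β)
    {m : V} (hm : m ∈ Submodule.span ℤ S) (hmu : B m u = 0) (hmw : B m w = 0)
    {κ j : ℤ} (hκ : B t m = κ) (hcop : IsCoprime (α - j * κ) β) :
    ∃ g ∈ G, ((g : (V →ₗ[ℚ] V)ˣ) : V →ₗ[ℚ] V) t = y := by
  obtain ⟨a, ha⟩ : ∃ a : V, a = u + (j : ℚ) • m := ⟨_, rfl⟩
  have haΛ : a ∈ Submodule.span ℤ S := by
    rw [ha]
    exact Submodule.add_mem _ hu (localTubeSpan_intCast_smul_mem S hm _)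
  have htu : B t u = 2 * β := by
    rw [ht, map_add, map_smul, LinearMap.add_apply, LinearMap.smul_apply, hyu, hβ, smul_eq_mul,
      zero_add]
  have hta : B t a = 2 * β + j * κ := by
    rw [ha, map_add, map_smul, htu, hκ, smul_eq_mul]
  have haw : B a w = 1 := by
    rw [ha, map_add, map_smul, LinearMap.add_apply, LinearMap.smul_apply, huw, hmw, smul_zero,
      add_zero]
  have hau : B a u = 0 := by
    rw [ha, map_add, map_smul, LinearMap.add_apply, LinearMap.smul_apply, hB.self_eq_zero, hmu,
      smul_zero, add_zero]
  obtain ⟨g, hg, hgv⟩ := hsq a haΛ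
  refine localTubeSpan_asymEngine_pull G hg
    (localTubeSpan_asymEngine_ofCoprime B hB S hint G hsq hu hw hδ hδu hδw y hyu hyw hyδ hyint
      (c := c - ((2 * β + j * κ : ℤ) : ℚ) • a)
      (Submodule.sub_mem _ hc (localTubeSpan_intCast_smul_mem S haΛ _)) ?_
      (α := α - j * κ + β * (-2)) (β := β) ?_ ?_ (hcop.add_mul_left_left (-2)))
  · rw [hgv, hta, ht]
    push_cast
    module
  · rw [map_sub, map_smul, LinearMap.sub_apply, LinearMap.smul_apply, hα, haw, smul_eq_mul]
    push_cast
    ring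
  · rw [map_sub, map_smul, LinearMap.sub_apply, LinearMap.smul_apply, hβ, hau, smul_zero,
      sub_zero]

/-- MOVE 1 along `w + jm`.  `t = y + 2c`, `(⟨c,w⟩, ⟨c,u⟩) = (α, β)`, `m ∈ ℤS ∩ {u, w}^⊥` with
`⟨t, m⟩ = κ`: the move along `a = w + jm` (`⟨t, a⟩ = 2α + jκ`, `⟨a, w⟩ = 0`, `⟨a, u⟩ = -1`) replaces
`(α, β)` by `(α, β + 2α + jκ)`, which is coprime as soon as `β + jκ` is coprime to `α`. [folklore] -/
theorem localTubeSpan_asymEngine_moveW (B : LinearMap.BilinForm ℚ V) (hB : B.IsAlt) (S : Set V)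
    (hint : ∀ δ ∈ S, ∀ δ' ∈ S, ∃ n : ℤ, B δ δ' = n)
    (G : Subgroup (V →ₗ[ℚ] V)ˣ)
    (hsq : ∀ a ∈ Submodule.span ℤ S, ∃ g ∈ G, ∀ v : V,
      ((g : (V →ₗ[ℚ] V)ˣ) : V →ₗ[ℚ] V) v = v - (2 : ℚ) • (B v a • a))
    {u w δ : V} (hu : u ∈ Submodule.span ℤ S) (hw : w ∈ Submodule.span ℤ S)
    (hδ : δ ∈ Submodule.span ℤ S) (huw : B u w = 1) (hδu : B δ u = 0) (hδw : B δ w = 0)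
    (y : V) (hyu : B y u = 0) (hyw : B y w = 0) (hyδ : B y δ = 1)
    (hyint : ∀ a ∈ Submodule.span ℤ S, ∃ z : ℤ, B y a = z)
    {t c : V} (hc : c ∈ Submodule.span ℤ S) (ht : t = y + (2 : ℚ) • c)
    {α β : ℤ} (hα : B c w = α) (hβ : B c u = β)
    {m : V} (hm : m ∈ Submodule.span ℤ S) (hmu : B m u = 0) (hmw : B m w = 0)
    {κ j : ℤ} (hκ : B t m = κ) (hcop : IsCoprime α (β + j * κ)) :
    ∃ g ∈ G, ((g : (V →ₗ[ℚ] V)ˣ) : V →ₗ[ℚ] V) t = y := by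
  obtain ⟨a, ha⟩ : ∃ a : V, a = w + (j : ℚ) • m := ⟨_, rfl⟩
  have haΛ : a ∈ Submodule.span ℤ S := by
    rw [ha]
    exact Submodule.add_mem _ hw (localTubeSpan_intCast_smul_mem S hm _)
  have hwu : B w u = -1 := by rw [← hB.neg_eq, huw]
  have htw : B t w = 2 * α := by
    rw [ht, map_add, map_smul, LinearMap.add_apply, LinearMap.smul_apply, hyw, hα, smul_eq_mul,
      zero_add]
  have hta : B t a = 2 * α + j * κ := by
    rw [ha, map_add, map_smul, htw, hκ, smul_eq_mul]
  have haw : B a w = 0 := by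
    rw [ha, map_add, map_smul, LinearMap.add_apply, LinearMap.smul_apply, hB.self_eq_zero, hmw,
      smul_zero, add_zero]
  have hau : B a u = -1 := by
    rw [ha, map_add, map_smul, LinearMap.add_apply, LinearMap.smul_apply, hwu, hmu, smul_zero,
      add_zero]
  obtain ⟨g, hg, hgv⟩ := hsq a haΛ
  refine localTubeSpan_asymEngine_pull G hg
    (localTubeSpan_asymEngine_ofCoprime B hB S hint G hsq hu hw hδ hδu hδw y hyu hyw hyδ hyint
      (c := c - ((2 * α + j * κ : ℤ) : ℚ) • a)
      (Submodule.sub_mem _ hc (localTubeSpan_intCast_smul_mem S haΛ _)) ?_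
      (α := α) (β := β + j * κ + α * 2) ?_ ?_ (hcop.symm.add_mul_left_left 2).symm)
  · rw [hgv, hta, ht]
    push_cast
    module
  · rw [map_sub, map_smul, LinearMap.sub_apply, LinearMap.smul_apply, hα, haw, smul_zero, sub_zero]
  · rw [map_sub, map_smul, LinearMap.sub_apply, LinearMap.smul_apply, hβ, hau, smul_eq_mul]
    push_cast
    ring

/-- **The asymmetric engine** (stub `stub_asymEngine` of the line `Sketch`, cycle 10).  `Λ = ℤS` with
`B` alternating and integral on `S`; `G` contains a unit acting as `T_a² : v ↦ v - 2⟨v,a⟩a` for every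
`a ∈ Λ`; `u, w, δ ∈ Λ` with `⟨u, w⟩ = 1`, `δ ⟂ u, w`; `y ⟂ u, w` with `⟨y, δ⟩ = 1` pairing integrally
with `Λ`.  Then every `t ∈ y + 2Λ` with a partner `x ∈ Λ` (`⟨t, x⟩ = 1`) satisfies `g t = y` for some
`g ∈ G`.  (The `{u,w}^⊥`-component `m = x - ⟨x,w⟩u + ⟨x,u⟩w` of the partner has
`⟨t, m⟩ = κ = 1 - 2⟨x,w⟩β + 2⟨x,u⟩α`, so `κ, α, β` are coprime and MOVE 1 with the coprime shift makes
`(α, β)` coprime; then MOVES 2–3.) [folklore] -/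
theorem localTubeSpan_asymEngine (B : LinearMap.BilinForm ℚ V) (hB : B.IsAlt) (S : Set V)
    (hint : ∀ δ ∈ S, ∀ δ' ∈ S, ∃ n : ℤ, B δ δ' = n)
    (G : Subgroup (V →ₗ[ℚ] V)ˣ)
    (hsq : ∀ a ∈ Submodule.span ℤ S, ∃ g ∈ G, ∀ v : V,
      ((g : (V →ₗ[ℚ] V)ˣ) : V →ₗ[ℚ] V) v = v - (2 : ℚ) • (B v a • a))
    {u w δ : V} (hu : u ∈ Submodule.span ℤ S) (hw : w ∈ Submodule.span ℤ S)
    (hδ : δ ∈ Submodule.span ℤ S) (huw : B u w = 1) (hδu : B δ u = 0) (hδw : B δ w = 0)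
    (y : V) (hyu : B y u = 0) (hyw : B y w = 0) (hyδ : B y δ = 1)
    (hyint : ∀ a ∈ Submodule.span ℤ S, ∃ z : ℤ, B y a = z)
    {t : V} (ht : ∃ c ∈ Submodule.span ℤ S, t = y + (2 : ℚ) • c)
    (htx : ∃ x ∈ Submodule.span ℤ S, B t x = 1) :
    ∃ g ∈ G, ((g : (V →ₗ[ℚ] V)ˣ) : V →ₗ[ℚ] V) t = y := by
  obtain ⟨c, hc, htc⟩ := ht
  obtain ⟨x, hx, htx1⟩ := htx
  obtain ⟨α, hα⟩ := localTubeSpan_integral_span B S hint hc hw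
  obtain ⟨β, hβ⟩ := localTubeSpan_integral_span B S hint hc hu
  obtain ⟨xw, hxw⟩ := localTubeSpan_integral_span B S hint hx hw
  obtain ⟨xu, hxu⟩ := localTubeSpan_integral_span B S hint hx hu
  have hwu : B w u = -1 := by rw [← hB.neg_eq, huw]
  have htu : B t u = 2 * β := by
    rw [htc, map_add, map_smul, LinearMap.add_apply, LinearMap.smul_apply, hyu, hβ, smul_eq_mul,
      zero_add]
  have htw : B t w = 2 * α := by
    rw [htc, map_add, map_smul, LinearMap.add_apply, LinearMap.smul_apply, hyw, hα, smul_eq_mul,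
      zero_add]
  -- the `{u,w}^⊥`-component `m` of the partner `x`, and its pairing `κ` with `t`
  obtain ⟨m, hm⟩ : ∃ m : V, m = x - (xw : ℚ) • u + (xu : ℚ) • w := ⟨_, rfl⟩
  have hmΛ : m ∈ Submodule.span ℤ S := by
    rw [hm]
    exact Submodule.add_mem _ (Submodule.sub_mem _ hx (localTubeSpan_intCast_smul_mem S hu _))
      (localTubeSpan_intCast_smul_mem S hw _)
  have hmu : B m u = 0 := by
    rw [hm]
    simp only [map_add, map_sub, map_smul, LinearMap.add_apply, LinearMap.sub_apply,
      LinearMap.smul_apply, smul_eq_mul, hxu, hB.self_eq_zero, hwu]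
    ring
  have hmw : B m w = 0 := by
    rw [hm]
    simp only [map_add, map_sub, map_smul, LinearMap.add_apply, LinearMap.sub_apply,
      LinearMap.smul_apply, smul_eq_mul, hxw, hB.self_eq_zero, huw]
    ring
  obtain ⟨κ, hκdef⟩ : ∃ κ : ℤ, κ = 1 - 2 * xw * β + 2 * xu * α := ⟨_, rfl⟩
  have hκ : B t m = κ := by
    rw [hm, hκdef]
    simp only [map_add, map_sub, map_smul, smul_eq_mul, htx1, htu, htw]
    push_cast
    ring
  by_cases hβ0 : β = 0
  · by_cases hα0 : α = 0
    · -- `α = β = 0`: `κ = 1`, and `j = -1` along `u + jm` yields the pair `(1, 0)`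
      refine localTubeSpan_asymEngine_moveU B hB S hint G hsq hu hw hδ huw hδu hδw y hyu hyw hyδ
        hyint hc htc hα hβ hmΛ hmu hmw hκ (j := -1) ?_
      have h1 : α - -1 * κ = 1 := by rw [hκdef, hα0, hβ0]; ring
      rw [h1]
      exact isCoprime_one_left
    · -- `β = 0 ≠ α`: coprime shift along `w + jm`
      obtain ⟨j, hj⟩ := localTubeSpan_coprimeShiftSub β α κ 1 (2 * xw) (-(2 * xu))
        (by rw [hκdef]; ring) hα0
      refine localTubeSpan_asymEngine_moveW B hB S hint G hsq hu hw hδ huw hδu hδw y hyu hyw hyδ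
        hyint hc htc hα hβ hmΛ hmu hmw hκ (j := -j) ?_
      rw [neg_mul, ← sub_eq_add_neg]
      exact hj.symm
  · -- `β ≠ 0`: coprime shift along `u + jm`
    obtain ⟨j, hj⟩ := localTubeSpan_coprimeShiftSub α β κ 1 (-(2 * xu)) (2 * xw)
      (by rw [hκdef]; ring) hβ0
    exact localTubeSpan_asymEngine_moveU B hB S hint G hsq hu hw hδ huw hδu hδw y hyu hyw hyδ hyint
      hc htc hα hβ hmΛ hmu hmw hκ hj

end Engine

end Summit.HodgeConjecture.HodgeConjecture.Theorems

end
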